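import Summits.BirchSwinnertonDyer.BirchSwinnertonDyer.Theses.KatoDescentPotSupersingular
import Summits.BirchSwinnertonDyer.BirchSwinnertonDyer.Theorems.KatoDescentPotSupersingularWildLowerSubgroupWitness
import Summits.BirchSwinnertonDyer.BirchSwinnertonDyer.Theorems.KatoDescentPotSupersingularWildLowerKimRoad
import Summits.BirchSwinnertonDyer.Rank1Residual.Additive.N11KimAtThreeDeepCertPUB
import Summits.BirchSwinnertonDyer.Rank1Residual.Additive.X4KimLargeImageKuriharaCertificate
import HarnessLib

/-!
# Route `KatoDescentPotSupersingular` (rung K9): crux `WildLowerHalfRankZero` (L₀, item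
# stmt-BirchSwinnertonDyer-19195) — KIM CERTIFICATES ALONG THE CLASS; the DEEP slot of the certificate
# road filled by KURIHARA NUMBERS instead of a second descent (`--supports` helper; seat k9-c2, gen 4)

Generations 2–3 (p421575, p431273) typed the per-class CERTIFICATE road over Cassels–Tate + Cassels +
GZK + modularity: a SHALLOW class (a member with `ord₃ #Ш_an ≤ 2`) is certified by one nonzero
`3`-torsion element of `Ш` (census 1 759 / 1 770 intrinsic classes `N < 5·10⁵`); a DEEP class
(`#Ш_an = 81`; the 11 single-curve classes 98280o1 105408k1 280962ce1 328320de1 386019q1 402624cj1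
413559be1 422253b1 440775g1 446904j1 496584bv1) needs an element of order `9` — a second `3`-descent,
for which the cell has no engine. Generation 0 (p418866) typed the KIM–KURIHARA road through rung W2's
leaf `N11.KimAtThreeRankZeroPUB` (Kim's formula at `p = 3` on tower-surjective rows with
`E(ℚ₃)[3] = 0`, NO reduction-type hypothesis at 3): ONE unit mod-3 Kurihara number `δ̃_{ℓ₁ℓ₂}` gives
`BSD₃` on a `3 ∤ ∏ c_ℓ` row — a modular-symbol computation, no descent. This file joins the two: §1 a
Kim certificate at ONE globally minimal member `W'` + Cassels' transport gives L₀ on the class (lanes: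
`t = 0` unit; `t = 0` index; the `t`-uniform DEEP lane `N11.KimAtThreeDeepCertPUB` of the kim3 memo
§16; the ANNOUNCED all-levels record `Kim2025.…_OPEN` for rows with `E(ℚ₃)[3] ≠ 0`); §2 a Kim
certificate IMPLIES generation 3's divisibility certificate at that member; §3 the crux BY NAME from
generation 2's shallow witnesses with the deep residual discharged by Kim certificates, from Kim
certificates on every class with NO Cassels–Tate input, and through generation 3's road.

EVIDENCE (kit j253114 / j253192; harvest-2 engine B sha256 d6da695bc822…, UNMODIFIED at `p = 3`, cross-
validated against PARI `msfromell` exact symbols on 12987a1 / 17928c1 / 11286q1, 42/42 Kurihara numbers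
identical): unit mod-3 Kurihara numbers at cyclic Kolyvagin levels on 98280o1 (`n = 4087`), 105408k1
(`481`), 280962ce1 (`9211`), 328320de1 (`2257`), 386019q1 (`1147`), 440775g1 (`2449`), 446904j1 (`2077`) —
`E(ℚ₃)[3] = 0`, `3 ∤ ∏ c_ℓ`, tower onto, Manin 1: §1's `t = 0` slot, 7 of the 11 deep classes; 402624cj1
(`4819`), 413559be1 (`793`), 496584bv1 (`559`) carry units but `#E(ℚ₃)[3] = 3` (announced lane);
422253b1 (`c₃ = 3`) has NO unit at 8 levels, as Kim's Conj. 1.10 predicts. Evidence tier; the slots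
below are HYPOTHESES.

HONEST LABEL: every theorem is conditional — on rung W2's leaf or its deep sibling (`@[conjecture]`
nodes carrying a refereed CELL memo of `bsd-addord`, NOT Literature facts) or on the announced record
(flag `Kim2025-preprint`), on Cassels / GZK / modularity (Cassels–Tate only with generation 2's slot),
and on per-class certificate SLOTS. Class-wide the slots are Kurihara's conjecture ⟺ Kato's IMC at 3
(Kim Conj. 1.3): the item's content (Kato Conj. 12.10 at the additive prime 3, open problem) is
unchanged; the item is NOT closed; BSD is not proved by any of this. Seat bsd-potss-k9-c2, generation 4.

References: [Kim2025RefinedTNC] Thm. 1.1/1.2; [Kim2022StructureSelmer] Thm. 1.9, Conj. 1.3/1.10; [Kurihara2014] §1;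
[MazurRubin2004] Prop. A.2; [Miller2011LMS] Def. 1.1; [MilneADT2006] Thm. I.7.3; [SilvermanAEC2009] Thm. X.4.14;
[Kato2004Asterisque] Conj. 12.10 (p. 224); memo `run/shared/lean/pub/bsd-addord/kim3/KIM3-PROOF.md` (Thm. A, Cor. C, §16).
-/

set_option autoImplicit false
-- sibling precedent (`KatoDescentPotSupersingularAssembly.lean`): the directory name repeats the summit name
set_option linter.dupNamespace false

noncomputable section

open scoped Classical
namespace Summit.BirchSwinnertonDyer.BirchSwinnertonDyer.Theorems

open WeierstrassCurve Literature.NumberTheory.EllipticCurves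
  Literature.NumberTheory.EllipticCurves.ModularForms
  Literature.NumberTheory.EllipticCurves.Rank1Residual
  Literature.NumberTheory.EllipticCurves.Rank1Residual.Typed
  Summit.BirchSwinnertonDyer.Rank1Residual.Additive
  Summit.BirchSwinnertonDyer.Rank1Residual
  Summit.BirchSwinnertonDyer.BirchSwinnertonDyer.Theses.KatoDescentPotSupersingular

/-! ## §1 Kim certificates at one member, transported along the class (Cassels) -/

/-- **L₀ at EVERY member of a wild rank-`0` class ONE globally minimal member `W'` of which carries a
`t = 0` KIM UNIT CERTIFICATE** (tower onto, `E(ℚ₃)[3] = 0`, a datum `D` with the period transfer —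
discharged on an optimal datum with `3 ∤ c_D` by `X4.periodTransfer_of_optimal` —, `3 ∤ ∏ c_ℓ(W')`, ONE
unit mod-3 Kurihara number at a cyclic Kolyvagin level): rung W2's leaf gives `BSD₃(W')`
(`N11.bsdp_three_of_kimAtThreeRankZeroPUB_of_kuriharaUnitAt`), Cassels' transport moves the lower half to
`W`. NO Cassels–Tate input. Census (kit j253114 / j253192): 98280o1, 105408k1, 280962ce1, 328320de1,
386019q1, 440775g1, 446904j1 (7 of the 11 deep classes).
Conditional; nothing credited. [cite: Kim2025RefinedTNC, Thm. 1.2 (rk 0)]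
[cite: Kim2022StructureSelmer, Thm. 1.9 (1) and (6)] [cite: MilneADT2006, Thm. I.7.3] [cite: Miller2011LMS, Def. 1.1] -/
theorem missingLowerBoundAt_wild_of_isIsogenous_kimUnitCert (hKim : N11.KimAtThreeRankZeroPUB)
    (hCassels : bsdRHS_eq_of_isIsogenous) (hGZK : rank_eq_analyticRank_of_analyticRank_le_one)
    (hmod : hasEntireLFunction_rat)
    (W : WeierstrassCurve ℚ) [W.IsElliptic] [W.IsGloballyMinimal] [Fact (3 : ℕ).Prime]
    (hr : W.analyticRank = 0) (_hO : ClassO6 W 3)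
    (W' : WeierstrassCurve ℚ) [W'.IsElliptic] [W'.IsGloballyMinimal] (hiso : IsIsogenous W W')
    (htower : ∀ n : ℕ, W'.HasSurjectiveModNGaloisRep (3 ^ n : ℕ))
    (ht0 : Nat.card {Q : (W'.baseChange ℚ_[3]).toAffine.Point // (3 : ℕ) • Q = 0} = 1)
    {N : ℕ} [NeZero N] (D : ModularParametrizationData W' N)
    (hper : ∃ u : ℚ, ‖(u : ℚ_[3])‖ = 1 ∧ W'.realPeriodRat = u * plusPeriod D.f)
    (htam : ¬ 3 ∣ W'.tamagawaProduct) (hKu : X4.KuriharaUnitAt W' 3 D.f) : MissingLowerBoundAt W 3 := by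
  have hr' : W'.analyticRank = 0 := by rw [← analyticRank_eq_of_isIsogenous' hiso, hr]
  have hL' : W'.entireLFunction 1 ≠ 0 := (W'.analyticRank_eq_zero_iff_holds (hmod W')).mp hr'
  have hr1 : W'.analyticRank ≤ 1 := by rw [hr']; exact zero_le_one
  haveI : Finite W'.sha := (hGZK W' hr1).2
  have hlow : MissingLowerBoundAt W' 3 :=
    (lower_and_upper_of_missingPPartAt W' 3 (missingPPartAt_of_bsdp W' 3
      (N11.bsdp_three_of_kimAtThreeRankZeroPUB_of_kuriharaUnitAt W' hKim hGZK htower ht0 hL' D hper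
        htam hKu))).1
  exact TwistComparison.missingLowerBoundAt_of_isIsogenous W' W 3 hCassels hGZK hmod
    hiso.symm_of_charZero hr1 hlow

/-- **The `t = 0` INDEX lane along the class** (`3 ∣ ∏ c_ℓ` rows, where Kim's Conj. 1.10 forbids a
unit): a member `W'` with the tower onto, `E(ℚ₃)[3] = 0`, a datum with `3 ∤ c_D` and the period transfer,
and ONE level-`k` Kurihara number `≢ 0 (mod 3^k)` at a cyclic level `n ∈ 𝒩_k`, `k − 1 ≤ v₃(∏ c_ℓ(W'))`,
gives L₀ at `W'` (`N11.missingLowerBoundAt_three_of_kimAtThreeRankZeroPUB_of_indexCert`), transported to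
`W` by Cassels. Census: the slot of 422253b1 (`c₃ = 3`; `k = 2` levels, not computed). Conditional.
[cite: Kim2022StructureSelmer, Thm. 1.9 (6), §1.5.1] [cite: MilneADT2006, Thm. I.7.3] [cite: Miller2011LMS, Def. 1.1] -/
theorem missingLowerBoundAt_wild_of_isIsogenous_kimIndexCert (hKim : N11.KimAtThreeRankZeroPUB)
    (hCassels : bsdRHS_eq_of_isIsogenous) (hGZK : rank_eq_analyticRank_of_analyticRank_le_one)
    (hmod : hasEntireLFunction_rat)
    (W : WeierstrassCurve ℚ) [W.IsElliptic] [W.IsGloballyMinimal] [Fact (3 : ℕ).Prime]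
    (hr : W.analyticRank = 0) (_hO : ClassO6 W 3)
    (W' : WeierstrassCurve ℚ) [W'.IsElliptic] [W'.IsGloballyMinimal] (hiso : IsIsogenous W W')
    (htower : ∀ n : ℕ, W'.HasSurjectiveModNGaloisRep (3 ^ n : ℕ))
    (ht0 : Nat.card {Q : (W'.baseChange ℚ_[3]).toAffine.Point // (3 : ℕ) • Q = 0} = 1)
    {N : ℕ} [NeZero N] (D : ModularParametrizationData W' N) (hc : ¬ (3 : ℤ) ∣ D.maninConstant)
    (hper : ∃ u : ℚ, ‖(u : ℚ_[3])‖ = 1 ∧ W'.realPeriodRat = u * plusPeriod D.f)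
    {k n : ℕ} [NeZero n] (hk : 1 ≤ k) (hn : Kato.IsKolyvaginProduct W' 3 k n)
    (hcyc : ∀ (ℓ : ℕ) [Fact ℓ.Prime], ℓ ∣ n →
      Nat.card {P : ((WeierstrassCurve.integralModelInt W').map
          (Int.castRingHom (ZMod ℓ))).toAffine.Point // 3 • P = 0} ≤ 3)
    (ψ : (ℓ : ℕ) → (ZMod ℓ)ˣ →* Multiplicative (ZMod (3 ^ k)))
    (hψ : ∀ ℓ ∈ n.primeFactors, Function.Surjective (ψ ℓ))
    (hδ : kuriharaNumber D.f (3 ^ k) n ψ ≠ 0) (hkt : k - 1 ≤ padicValNat 3 W'.tamagawaProduct) :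
    MissingLowerBoundAt W 3 := by
  have hr' : W'.analyticRank = 0 := by rw [← analyticRank_eq_of_isIsogenous' hiso, hr]
  have hL' : W'.entireLFunction 1 ≠ 0 := (W'.analyticRank_eq_zero_iff_holds (hmod W')).mp hr'
  have hr1 : W'.analyticRank ≤ 1 := by rw [hr']; exact zero_le_one
  have hsurj : Surj W' 3 := by have h := htower 1; rwa [pow_one] at h
  have hlow : MissingLowerBoundAt W' 3 :=
    N11.missingLowerBoundAt_three_of_kimAtThreeRankZeroPUB_of_indexCert W' hKim hGZK hsurj htower ht0
      hL' D hc hper hk hn hcyc ψ hψ hδ hkt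
  exact TwistComparison.missingLowerBoundAt_of_isIsogenous W' W 3 hCassels hGZK hmod
    hiso.symm_of_charZero hr1 hlow

/-- **The `t`-uniform DEEP lane along the class** (`E(ℚ₃)[3] ≠ 0` allowed; kim3 memo §16 Cor. C-t as
the name `N11.KimAtThreeDeepCertPUB`): a member `W'` with the tower onto, `#E(ℚ₃)[9] ≤ 3^t`, a datum
with the period transfer, and ONE unit mod-3 Kurihara number at a cyclic level of DEPTH `k ≥ 2 + t`
gives L₀ at `W'` with no Tamagawa hypothesis (`N11.missingLowerBoundAt_three_of_kimAtThreeDeepCertPUB_of_unit`),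
transported by Cassels. Census: the refereed slot of 402624cj1 / 413559be1 / 496584bv1
(`#E(ℚ₃)[3] = 3`; depth-3 levels `ℓ ≡ 1 (27)`, not computed). Conditional; nothing credited.
[cite: Kim2022StructureSelmer, Thm. 1.9 (6)] [cite: MazurRubin2004, Prop. A.2] [cite: MilneADT2006, Thm. I.7.3] -/
theorem missingLowerBoundAt_wild_of_isIsogenous_kimDeepUnitCert (hKd : N11.KimAtThreeDeepCertPUB)
    (hCassels : bsdRHS_eq_of_isIsogenous) (hGZK : rank_eq_analyticRank_of_analyticRank_le_one)
    (hmod : hasEntireLFunction_rat)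
    (W : WeierstrassCurve ℚ) [W.IsElliptic] [W.IsGloballyMinimal] [Fact (3 : ℕ).Prime]
    (hr : W.analyticRank = 0) (_hO : ClassO6 W 3)
    (W' : WeierstrassCurve ℚ) [W'.IsElliptic] [W'.IsGloballyMinimal] (hiso : IsIsogenous W W')
    (htower : ∀ n : ℕ, W'.HasSurjectiveModNGaloisRep (3 ^ n : ℕ))
    {N : ℕ} [NeZero N] (D : ModularParametrizationData W' N)
    (hper : ∃ u : ℚ, ‖(u : ℚ_[3])‖ = 1 ∧ W'.realPeriodRat = u * plusPeriod D.f)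
    {t k n : ℕ} [NeZero n]
    (ht : Nat.card {Q : (W'.baseChange ℚ_[3]).toAffine.Point // (9 : ℕ) • Q = 0} ≤ 3 ^ t)
    (hk : 2 + t ≤ k) (hn : Kato.IsKolyvaginProduct W' 3 k n)
    (hcyc : ∀ (ℓ : ℕ) [Fact ℓ.Prime], ℓ ∣ n →
      Nat.card {P : ((WeierstrassCurve.integralModelInt W').map
          (Int.castRingHom (ZMod ℓ))).toAffine.Point // 3 • P = 0} ≤ 3)
    (ψ : (ℓ : ℕ) → (ZMod ℓ)ˣ →* Multiplicative (ZMod (3 ^ 1)))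
    (hψ : ∀ ℓ ∈ n.primeFactors, Function.Surjective (ψ ℓ))
    (hδ : kuriharaNumber D.f (3 ^ 1) n ψ ≠ 0) : MissingLowerBoundAt W 3 := by
  have hr' : W'.analyticRank = 0 := by rw [← analyticRank_eq_of_isIsogenous' hiso, hr]
  have hL' : W'.entireLFunction 1 ≠ 0 := (W'.analyticRank_eq_zero_iff_holds (hmod W')).mp hr'
  have hr1 : W'.analyticRank ≤ 1 := by rw [hr']; exact zero_le_one
  have hlow : MissingLowerBoundAt W' 3 :=
    N11.missingLowerBoundAt_three_of_kimAtThreeDeepCertPUB_of_unit W' hKd hGZK htower hL' D hper ht hk hn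
      hcyc ψ hψ hδ
  exact TwistComparison.missingLowerBoundAt_of_isIsogenous W' W 3 hCassels hGZK hmod
    hiso.symm_of_charZero hr1 hlow

/-- **The ANNOUNCED all-levels lane at the row** (Kim arXiv:2505.09121 Thm. 1.1, any `t`; the tree's
OPEN record, flag `Kim2025-preprint`): a wild rank-`0` row with the tower onto (so X4), a datum with
`3 ∤ c_D` and the period transfer, `3 ∤ ∏ c_ℓ` and ONE unit mod-3 Kurihara number at a cyclic level has
`BSD₃` (`X4RankZero.bsdp_of_kim2025_OPEN_of_kuriharaUnitAt`), hence L₀ — WITHOUT the `E(ℚ₃)[3] = 0`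
binder. Census: 402624cj1 (`n = 4819`), 413559be1 (`793`), 496584bv1 (`559`): `#E(ℚ₃)[3] = 3`, Kodaira II.
Conditional on an announced record. [claim: Kim2025RefinedTNC, status: under-review]
[cite: Kim2025RefinedTNC, Thm. 1.1 (ANNOUNCED, OPEN binder)] [cite: Miller2011LMS, Def. 1.1] -/
theorem missingLowerBoundAt_wild_of_kim2025_OPEN_of_kuriharaUnitAt
    (hKim25u : Kim2025.rankZero_padicValRat_sha_of_kuriharaNumber_ne_zero_of_towerSurj_OPEN)
    (hGZK : rank_eq_analyticRank_of_analyticRank_le_one) (hmod : hasEntireLFunction_rat)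
    (W : WeierstrassCurve ℚ) [W.IsElliptic] [W.IsGloballyMinimal] [Fact (3 : ℕ).Prime]
    (hr : W.analyticRank = 0) (hO : ClassO6 W 3)
    (htower : ∀ n : ℕ, W.HasSurjectiveModNGaloisRep (3 ^ n : ℕ))
    {N : ℕ} [NeZero N] (D : ModularParametrizationData W N) (hc : ¬ (3 : ℤ) ∣ D.maninConstant)
    (hper : ∃ u : ℚ, ‖(u : ℚ_[3])‖ = 1 ∧ W.realPeriodRat = u * plusPeriod D.f)
    (htam : ¬ 3 ∣ W.tamagawaProduct) (hKu : X4.KuriharaUnitAt W 3 D.f) : MissingLowerBoundAt W 3 := by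
  have hX : ClassX4 W 3 :=
    ⟨hO.1, hO.2.1, hasIrreducibleModPGaloisRep_of_hasSurjectiveModNGaloisRep W 3 (by simpa using htower 1)⟩
  exact (lower_and_upper_of_missingPPartAt W 3 (X4RankZero.bsdp_of_kim2025_OPEN_of_kuriharaUnitAt W 3
    hKim25u hGZK hmod hr hX htower D hc hper htam hKu).2).1

/-! ## §2 A Kim certificate IS a divisibility certificate (generation 3's slot) -/

/-- **A `t = 0` Kim unit certificate at `W'` fills generation 3's divisibility slot at `W'`**: rung
W2's leaf gives `BSD₃(W')`, so with `k := ord₃ #Ш(W')`, `3^k ∣ #Ш(W')` and `ord₃ #Ш_an(W') = k ≤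
k + (k mod 2)` — the `hwit` shape of `wildLowerHalfRankZero_of_dvdWitnesses` (p431273). Conditional.
[cite: Kim2025RefinedTNC, Thm. 1.2 (rk 0)] [cite: Miller2011LMS, Def. 1.1] -/
theorem dvdWitness_of_kimUnitCert (hKim : N11.KimAtThreeRankZeroPUB)
    (hGZK : rank_eq_analyticRank_of_analyticRank_le_one) (hmod : hasEntireLFunction_rat)
    (W' : WeierstrassCurve ℚ) [W'.IsElliptic] [W'.IsGloballyMinimal] [Fact (3 : ℕ).Prime]
    (hr' : W'.analyticRank = 0)
    (htower : ∀ n : ℕ, W'.HasSurjectiveModNGaloisRep (3 ^ n : ℕ))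
    (ht0 : Nat.card {Q : (W'.baseChange ℚ_[3]).toAffine.Point // (3 : ℕ) • Q = 0} = 1)
    {N : ℕ} [NeZero N] (D : ModularParametrizationData W' N)
    (hper : ∃ u : ℚ, ‖(u : ℚ_[3])‖ = 1 ∧ W'.realPeriodRat = u * plusPeriod D.f)
    (htam : ¬ 3 ∣ W'.tamagawaProduct) (hKu : X4.KuriharaUnitAt W' 3 D.f) :
    ∃ (q' : ℚ) (k : ℕ), shaAn W' = (q' : ℂ) ∧ padicValRat 3 q' ≤ ((k + k % 2 : ℕ) : ℤ) ∧
      3 ^ k ∣ W'.shaOrder := by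
  have hL' : W'.entireLFunction 1 ≠ 0 := (W'.analyticRank_eq_zero_iff_holds (hmod W')).mp hr'
  haveI : Finite W'.sha := (hGZK W' (by rw [hr']; exact zero_le_one)).2
  obtain ⟨q', hq', hv'⟩ := missingPPartAt_of_bsdp W' 3
    (N11.bsdp_three_of_kimAtThreeRankZeroPUB_of_kuriharaUnitAt W' hKim hGZK htower ht0 hL' D hper htam hKu)
  refine ⟨q', padicValNat 3 W'.shaOrder, hq', ?_, pow_padicValNat_dvd⟩
  rw [hv']
  exact_mod_cast Nat.le_add_right _ _

/-! ## §3 The crux BY NAME -/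

/-- **`WildLowerHalfRankZero` from the published inputs, generation 2's SHALLOW witness slot, and a KIM
CERTIFICATE on every DEEP class.** Cassels–Tate `hCT` (shallow rows only), Cassels, GZK, modularity;
rung W2's leaf `hKim` and its deep sibling `hKd` (refereed cell memo; `@[conjecture]` nodes); `hwit`
VERBATIM from `wildLowerHalfRankZero_of_shallowWitnesses_of_deepRows`; `hkim`: on every DEEP row SOME
globally minimal member `W'` with the tower onto and a datum with the period transfer carries ONE of (a)
`E(ℚ₃)[3] = 0`, `3 ∤ ∏ c_ℓ`, a unit mod-3 Kurihara number; (b) `E(ℚ₃)[3] = 0`, `3 ∤ c_D`, a level-`k`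
number `≢ 0 (mod 3^k)`, `k − 1 ≤ v₃(∏ c_ℓ)`; (c) a unit at depth `k ≥ 2 + t`, `#E(ℚ₃)[9] ≤ 3^t`.
Census (kit j253114 / j253192): (a) on 98280o1, 105408k1, 280962ce1, 328320de1, 386019q1, 440775g1,
446904j1; 422253b1 slot (b); 402624cj1 / 413559be1 / 496584bv1 slot (c). Class-wide `hwit ∧ hkim` is the crux's own content.
Conditional; the item is NOT closed. [cite: Kim2025RefinedTNC, Thm. 1.1/1.2] [cite: Kim2022StructureSelmer, Thm. 1.9 (6)]
[cite: SilvermanAEC2009, Thm. X.4.14] [cite: MilneADT2006, Thm. I.7.3] [cite: Miller2011LMS, Def. 1.1] -/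
theorem wildLowerHalfRankZero_of_shallowWitnesses_of_kimDeepCerts
    (hCT : exists_casselsTate_pairing (K := ℚ)) (hCassels : bsdRHS_eq_of_isIsogenous)
    (hGZK : rank_eq_analyticRank_of_analyticRank_le_one) (hmod : hasEntireLFunction_rat)
    (hKim : N11.KimAtThreeRankZeroPUB) (hKd : N11.KimAtThreeDeepCertPUB)
    (hwit : ∀ (W : WeierstrassCurve ℚ) [W.IsElliptic] [W.IsGloballyMinimal] [Fact (3 : ℕ).Prime],
      W.analyticRank = 0 → ClassO6 W 3 →
      (∀ (W' : WeierstrassCurve ℚ) [W'.IsElliptic] [W'.IsGloballyMinimal], IsIsogenous W W' →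
        ∀ q' : ℚ, shaAn W' = (q' : ℂ) → 0 < padicValRat 3 q') →
      (∃ (W' : WeierstrassCurve ℚ) (_ : W'.IsElliptic) (_ : W'.IsGloballyMinimal),
        IsIsogenous W W' ∧ ∃ q' : ℚ, shaAn W' = (q' : ℂ) ∧ padicValRat 3 q' ≤ 2) →
      ∃ (W' : WeierstrassCurve ℚ) (_ : W'.IsElliptic) (_ : W'.IsGloballyMinimal),
        IsIsogenous W W' ∧ ∃ q' : ℚ, shaAn W' = (q' : ℂ) ∧ padicValRat 3 q' ≤ 2 ∧
          ∃ x : W'.sha, x ≠ 0 ∧ 3 • x = 0)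
    (hkim : ∀ (W : WeierstrassCurve ℚ) [W.IsElliptic] [W.IsGloballyMinimal] [Fact (3 : ℕ).Prime],
      W.analyticRank = 0 → ClassO6 W 3 →
      (∀ (W' : WeierstrassCurve ℚ) [W'.IsElliptic] [W'.IsGloballyMinimal], IsIsogenous W W' →
        ∀ q' : ℚ, shaAn W' = (q' : ℂ) → 2 < padicValRat 3 q') →
      ∃ (W' : WeierstrassCurve ℚ) (_ : W'.IsElliptic) (_ : W'.IsGloballyMinimal),
        IsIsogenous W W' ∧ (∀ n : ℕ, W'.HasSurjectiveModNGaloisRep (3 ^ n : ℕ)) ∧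
        ∃ (N : ℕ) (_ : NeZero N) (D : ModularParametrizationData W' N),
          (∃ u : ℚ, ‖(u : ℚ_[3])‖ = 1 ∧ W'.realPeriodRat = u * plusPeriod D.f) ∧
          ((Nat.card {Q : (W'.baseChange ℚ_[3]).toAffine.Point // (3 : ℕ) • Q = 0} = 1 ∧
              ¬ 3 ∣ W'.tamagawaProduct ∧ X4.KuriharaUnitAt W' 3 D.f) ∨
            (Nat.card {Q : (W'.baseChange ℚ_[3]).toAffine.Point // (3 : ℕ) • Q = 0} = 1 ∧
              ¬ (3 : ℤ) ∣ D.maninConstant ∧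
              ∃ (k n : ℕ) (_ : NeZero n), 1 ≤ k ∧ Kato.IsKolyvaginProduct W' 3 k n ∧
                (∀ (ℓ : ℕ) [Fact ℓ.Prime], ℓ ∣ n →
                  Nat.card {P : ((WeierstrassCurve.integralModelInt W').map
                      (Int.castRingHom (ZMod ℓ))).toAffine.Point // 3 • P = 0} ≤ 3) ∧
                ∃ ψ : (ℓ : ℕ) → (ZMod ℓ)ˣ →* Multiplicative (ZMod (3 ^ k)),
                  (∀ ℓ ∈ n.primeFactors, Function.Surjective (ψ ℓ)) ∧
                  kuriharaNumber D.f (3 ^ k) n ψ ≠ 0 ∧ k - 1 ≤ padicValNat 3 W'.tamagawaProduct) ∨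
            (∃ (t k n : ℕ) (_ : NeZero n),
              Nat.card {Q : (W'.baseChange ℚ_[3]).toAffine.Point // (9 : ℕ) • Q = 0} ≤ 3 ^ t ∧
              2 + t ≤ k ∧ Kato.IsKolyvaginProduct W' 3 k n ∧
              (∀ (ℓ : ℕ) [Fact ℓ.Prime], ℓ ∣ n →
                Nat.card {P : ((WeierstrassCurve.integralModelInt W').map
                    (Int.castRingHom (ZMod ℓ))).toAffine.Point // 3 • P = 0} ≤ 3) ∧
              ∃ ψ : (ℓ : ℕ) → (ZMod ℓ)ˣ →* Multiplicative (ZMod (3 ^ 1)),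
                (∀ ℓ ∈ n.primeFactors, Function.Surjective (ψ ℓ)) ∧
                kuriharaNumber D.f (3 ^ 1) n ψ ≠ 0))) :
    Summit.BirchSwinnertonDyer.BirchSwinnertonDyer.Theses.KatoDescentPotSupersingular.WildLowerHalfRankZero :=
  wildLowerHalfRankZero_of_shallowWitnesses_of_deepRows hCT hCassels hGZK hmod hwit
    fun W _ _ _ hr hO hdeepRow ↦ by
      obtain ⟨W', hW', hM', hiso, htower, N, hN, D, hper, hcert⟩ := hkim W hr hO hdeepRow
      haveI := hW'
      haveI := hM'
      haveI := hN
      rcases hcert with ⟨ht0, htam, hKu⟩ | ⟨ht0, hc, k, n, hn0, hk, hn, hcyc, ψ, hψ, hδ, hkt⟩ |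
          ⟨t, k, n, hn0, ht, hk, hn, hcyc, ψ, hψ, hδ⟩
      · exact missingLowerBoundAt_wild_of_isIsogenous_kimUnitCert hKim hCassels hGZK hmod W hr hO W' hiso
          htower ht0 D hper htam hKu
      · haveI := hn0
        exact missingLowerBoundAt_wild_of_isIsogenous_kimIndexCert hKim hCassels hGZK hmod W hr hO W' hiso
          htower ht0 D hc hper hk hn hcyc ψ hψ hδ hkt
      · haveI := hn0
        exact missingLowerBoundAt_wild_of_isIsogenous_kimDeepUnitCert hKd hCassels hGZK hmod W hr hO W'
          hiso htower D hper ht hk hn hcyc ψ hψ hδ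

/-- **The CASSELS–TATE-FREE Kim composition**: the crux BY NAME from rung W2's leaf, Cassels, GZK,
modularity, a `t = 0` Kim unit certificate at SOME globally minimal member of the class (`hcert`), and
the remaining rows displayed (`hres`: classes with no tower-surjective, `E(ℚ₃)[3] = 0`, `3 ∤ ∏ c_ℓ`
member) — the class-level form of generation 0's row-level composition. Class-wide `hcert` is Kurihara's
conjecture ⟺ Kato's IMC at 3 (Kim Conj. 1.3). Conditional; the item is NOT closed.
[cite: Kim2025RefinedTNC, Thm. 1.1/1.2] [cite: Kurihara2014, §1] [cite: MilneADT2006, Thm. I.7.3] -/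
theorem wildLowerHalfRankZero_of_kimClassCerts_of_residualRows (hKim : N11.KimAtThreeRankZeroPUB)
    (hCassels : bsdRHS_eq_of_isIsogenous) (hGZK : rank_eq_analyticRank_of_analyticRank_le_one)
    (hmod : hasEntireLFunction_rat)
    (hcert : ∀ (W : WeierstrassCurve ℚ) [W.IsElliptic] [W.IsGloballyMinimal] [Fact (3 : ℕ).Prime],
      W.analyticRank = 0 → ClassO6 W 3 →
      (∃ (W' : WeierstrassCurve ℚ) (_ : W'.IsElliptic) (_ : W'.IsGloballyMinimal),
        IsIsogenous W W' ∧ (∀ n : ℕ, W'.HasSurjectiveModNGaloisRep (3 ^ n : ℕ)) ∧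
        Nat.card {Q : (W'.baseChange ℚ_[3]).toAffine.Point // (3 : ℕ) • Q = 0} = 1 ∧
        ¬ 3 ∣ W'.tamagawaProduct) →
      ∃ (W' : WeierstrassCurve ℚ) (_ : W'.IsElliptic) (_ : W'.IsGloballyMinimal),
        IsIsogenous W W' ∧ (∀ n : ℕ, W'.HasSurjectiveModNGaloisRep (3 ^ n : ℕ)) ∧
        Nat.card {Q : (W'.baseChange ℚ_[3]).toAffine.Point // (3 : ℕ) • Q = 0} = 1 ∧
        ¬ 3 ∣ W'.tamagawaProduct ∧
        ∃ (N : ℕ) (_ : NeZero N) (D : ModularParametrizationData W' N),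
          (∃ u : ℚ, ‖(u : ℚ_[3])‖ = 1 ∧ W'.realPeriodRat = u * plusPeriod D.f) ∧
            X4.KuriharaUnitAt W' 3 D.f)
    (hres : ∀ (W : WeierstrassCurve ℚ) [W.IsElliptic] [W.IsGloballyMinimal] [Fact (3 : ℕ).Prime],
      W.analyticRank = 0 → ClassO6 W 3 →
      (¬ ∃ (W' : WeierstrassCurve ℚ) (_ : W'.IsElliptic) (_ : W'.IsGloballyMinimal),
        IsIsogenous W W' ∧ (∀ n : ℕ, W'.HasSurjectiveModNGaloisRep (3 ^ n : ℕ)) ∧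
        Nat.card {Q : (W'.baseChange ℚ_[3]).toAffine.Point // (3 : ℕ) • Q = 0} = 1 ∧
        ¬ 3 ∣ W'.tamagawaProduct) → MissingLowerBoundAt W 3) :
    Summit.BirchSwinnertonDyer.BirchSwinnertonDyer.Theses.KatoDescentPotSupersingular.WildLowerHalfRankZero := by
  intro W _ _ _ hr hO
  by_cases h : ∃ (W' : WeierstrassCurve ℚ) (_ : W'.IsElliptic) (_ : W'.IsGloballyMinimal),
      IsIsogenous W W' ∧ (∀ n : ℕ, W'.HasSurjectiveModNGaloisRep (3 ^ n : ℕ)) ∧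
      Nat.card {Q : (W'.baseChange ℚ_[3]).toAffine.Point // (3 : ℕ) • Q = 0} = 1 ∧
      ¬ 3 ∣ W'.tamagawaProduct
  · obtain ⟨W', hW', hM', hiso, htower, ht0, htam, N, hN, D, hper, hKu⟩ := hcert W hr hO h
    haveI := hW'
    haveI := hM'
    haveI := hN
    exact missingLowerBoundAt_wild_of_isIsogenous_kimUnitCert hKim hCassels hGZK hmod W hr hO W' hiso
      htower ht0 D hper htam hKu
  · exact hres W hr hO h

/-- **Generation 3's certificate road accepts Kim certificates**: the crux BY NAME from Cassels–Tate,
Cassels, GZK, modularity, rung W2's leaf, and on every wild rank-`0` row SOME globally minimal member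
carrying EITHER a divisibility certificate (`3^k ∣ #Ш(W')`, `ord₃ #Ш_an ≤ k + (k mod 2)`) OR a `t = 0`
Kim unit certificate — converted by `dvdWitness_of_kimUnitCert` and fed to
`wildLowerHalfRankZero_of_dvdWitnesses`. Census: 1 759 shallow + 7 deep classes instantiated.
Conditional; the item is NOT closed. [cite: Kim2025RefinedTNC, Thm. 1.2 (rk 0)]
[cite: SilvermanAEC2009, Thm. X.4.14] [cite: MilneADT2006, Thm. I.7.3] [cite: Miller2011LMS, Def. 1.1] -/
theorem wildLowerHalfRankZero_of_dvdOrKimWitnesses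
    (hCT : exists_casselsTate_pairing (K := ℚ)) (hCassels : bsdRHS_eq_of_isIsogenous)
    (hGZK : rank_eq_analyticRank_of_analyticRank_le_one) (hmod : hasEntireLFunction_rat)
    (hKim : N11.KimAtThreeRankZeroPUB)
    (hwit : ∀ (W : WeierstrassCurve ℚ) [W.IsElliptic] [W.IsGloballyMinimal] [Fact (3 : ℕ).Prime],
      W.analyticRank = 0 → ClassO6 W 3 →
      ∃ (W' : WeierstrassCurve ℚ) (_ : W'.IsElliptic) (_ : W'.IsGloballyMinimal),
        IsIsogenous W W' ∧
        ((∃ (q' : ℚ) (k : ℕ),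
            shaAn W' = (q' : ℂ) ∧ padicValRat 3 q' ≤ ((k + k % 2 : ℕ) : ℤ) ∧ 3 ^ k ∣ W'.shaOrder) ∨
          ((∀ n : ℕ, W'.HasSurjectiveModNGaloisRep (3 ^ n : ℕ)) ∧
            Nat.card {Q : (W'.baseChange ℚ_[3]).toAffine.Point // (3 : ℕ) • Q = 0} = 1 ∧
            ¬ 3 ∣ W'.tamagawaProduct ∧
            ∃ (N : ℕ) (_ : NeZero N) (D : ModularParametrizationData W' N),
              (∃ u : ℚ, ‖(u : ℚ_[3])‖ = 1 ∧ W'.realPeriodRat = u * plusPeriod D.f) ∧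
                X4.KuriharaUnitAt W' 3 D.f))) :
    Summit.BirchSwinnertonDyer.BirchSwinnertonDyer.Theses.KatoDescentPotSupersingular.WildLowerHalfRankZero :=
  wildLowerHalfRankZero_of_dvdWitnesses hCT hCassels hGZK hmod fun W _ _ _ hr hO ↦ by
    obtain ⟨W', hW', hM', hiso, hcert⟩ := hwit W hr hO
    haveI := hW'
    haveI := hM'
    refine ⟨W', hW', hM', hiso, ?_⟩
    rcases hcert with hdvd | ⟨htower, ht0, htam, N, hN, D, hper, hKu⟩
    · exact hdvd
    · haveI := hN
      have hr' : W'.analyticRank = 0 := by rw [← analyticRank_eq_of_isIsogenous' hiso, hr]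
      exact dvdWitness_of_kimUnitCert hKim hGZK hmod W' hr' htower ht0 D hper htam hKu

/-- **The crux from the ANNOUNCED record, Kurihara's conjecture on the tower-surjective `3 ∤ ∏ c_ℓ`
rows (ANY `t`), and the REMAINING rows displayed** (`hres`: tower not onto, or `3 ∣ ∏ c_ℓ`) —
generation 0's `…_of_kuriharaUnits_of_residualRows` with the `E(ℚ₃)[3] = 0` clause moved out of the
residual at the price of the announced record (census: the rows of 402624cj1 / 413559be1 / 496584bv1). Conditional; the item is NOT closed.
[claim: Kim2025RefinedTNC, status: under-review] [cite: Kim2025RefinedTNC, Thm. 1.1 (ANNOUNCED, OPEN binder)]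
[cite: Kurihara2014, §1] [cite: Miller2011LMS, Def. 1.1] -/
theorem wildLowerHalfRankZero_of_kim2025_OPEN_of_kuriharaUnits_of_residualRows
    (hKim25u : Kim2025.rankZero_padicValRat_sha_of_kuriharaNumber_ne_zero_of_towerSurj_OPEN)
    (hGZK : rank_eq_analyticRank_of_analyticRank_le_one) (hmod : hasEntireLFunction_rat)
    (hKur : ∀ (W : WeierstrassCurve ℚ) [W.IsElliptic] [W.IsGloballyMinimal],
      W.analyticRank = 0 → ClassO6 W 3 → (∀ n : ℕ, W.HasSurjectiveModNGaloisRep (3 ^ n : ℕ)) →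
      ¬ 3 ∣ W.tamagawaProduct →
        ∃ (N : ℕ) (_ : NeZero N) (D : ModularParametrizationData W N), ¬ (3 : ℤ) ∣ D.maninConstant ∧
          (∃ u : ℚ, ‖(u : ℚ_[3])‖ = 1 ∧ W.realPeriodRat = u * plusPeriod D.f) ∧
            X4.KuriharaUnitAt W 3 D.f)
    (hres : ∀ (W : WeierstrassCurve ℚ) [W.IsElliptic] [W.IsGloballyMinimal] [Fact (3 : ℕ).Prime],
      W.analyticRank = 0 → ClassO6 W 3 →
      ¬ ((∀ n : ℕ, W.HasSurjectiveModNGaloisRep (3 ^ n : ℕ)) ∧ ¬ 3 ∣ W.tamagawaProduct) →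
        MissingLowerBoundAt W 3) :
    Summit.BirchSwinnertonDyer.BirchSwinnertonDyer.Theses.KatoDescentPotSupersingular.WildLowerHalfRankZero := by
  intro W _ _ _ hr hO
  by_cases h : (∀ n : ℕ, W.HasSurjectiveModNGaloisRep (3 ^ n : ℕ)) ∧ ¬ 3 ∣ W.tamagawaProduct
  · obtain ⟨N, hN, D, hc, hper, hKu⟩ := hKur W hr hO h.1 h.2
    haveI := hN
    exact missingLowerBoundAt_wild_of_kim2025_OPEN_of_kuriharaUnitAt hKim25u hGZK hmod W hr hO h.1 D hc
      hper h.2 hKu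
  · exact hres W hr hO h

end Summit.BirchSwinnertonDyer.BirchSwinnertonDyer.Theorems

end
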